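import Mathlib.RingTheory.SimpleModule.Basic
import Literature.AlgebraicGeometry.Motives.TateAbelianFiniteLattice
import Literature.AlgebraicGeometry.Motives.AbelianVarietyIsogenyProofs
import HarnessLib

/-!
# Tate 1966: the double-centraliser and saturation steps of the Main Theorem (abelian varieties)

Fourth file of the decomposition of Tate's Main Theorem — the named fact
`Literature.AlgebraicGeometry.Motives.tate_bijective_of_finite A B ℓ` of
`Literature.AlgebraicGeometry.Motives.TateAbelianFinite` (J. Tate, *Endomorphisms of abelian
varieties over finite fields*, Invent. Math. 2 (1966), 134–144, Main Theorem: for abelian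
varieties `A, B` over a finite field `k` and a prime `ℓ ≠ char k` the Tate map
`ℤ_ℓ ⊗ Hom_k(A, B) → Hom_Γ(T_ℓ A, T_ℓ B)` is bijective) — along its printed proof, after
`TateAbelianFiniteSteps` (the graph argument for the isogeny criterion, `V_ℓ` on morphisms,
`E_ℓ(P)`, the property `tateSubspaceRealization`), `TateLatticeLimitProofs` (`ℓ`-adic
compactness) and `TateAbelianFiniteLattice` (the **lattice lemma**
`tateSubspaceRealization_of_finite_of_quotient`: over a finite `K`, every `Γ_K`-stable
`ℚ_ℓ`-subspace of `V_ℓ P` is `u(V_ℓ P)` for some `u ∈ E_ℓ(P)`, from named facts). The paper is not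
held by the project; the architecture is that of J. Kieffer, *Isogeny graphs of abelian varieties
over finite fields* (2024), §1.2.4, pp. 28–32 (held, read) and J. S. Milne, *The Work of John
Tate*, §4.3.1 (held, read). This file proves the two remaining steps and assembles the Main Theorem
from named facts of the theory of abelian varieties:

1. **The double-centraliser step** (Tate 1966, §3; Kieffer, Prop. 1.2.26; Milne §4.3.1 (c)) —
   `mem_span_rationalTateModuleMap_of_tateSubspaceRealization`: for a bicone `b` on `(A, B)`
   (the product `P = A × B`), if `tateSubspaceRealization P ℓ` holds and the `ℚ_ℓ`-algebra
   `E_ℓ(P)` (the image of `ℚ_ℓ ⊗ End_K(P)` in `End_{ℚ_ℓ}(V_ℓ P)`, `rationalEndSubalgebra P ℓ`)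
   is semisimple, then every `Γ_K`-equivariant `ℚ_ℓ`-linear `g : V_ℓ A → V_ℓ B` lies in the
   `ℚ_ℓ`-span of the `V_ℓ f`, `f ∈ Hom_K(A, B)`. *Proof.* The graph `W ⊆ V_ℓ P` of `g` is
   `Γ_K`-stable, so `W = u(V_ℓ P)` with `u ∈ E_ℓ(P)`; hence every `d` in the centraliser `D` of
   `E_ℓ(P)` maps `W` into itself (`d u V = u d V ⊆ u V`, Kieffer, proof of Lemma 1.2.24), and,
   commuting also with the idempotents `V(inl) V(fst)`, `V(inr) V(snd) ∈ E_ℓ(P)`, it commutes with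
   `g̃ = V(inr) ∘ g ∘ V(fst)` (`comp_graphMap_eq_of_mapsTo`, pure linear algebra). By the
   double-centraliser theorem in bicommutant form — here **Mathlib's Jacobson density theorem**
   `jacobson_density` for the semisimple `E_ℓ(P)`-module `V_ℓ P`
   (`mem_range_of_forall_commute_of_isSemisimpleRing`, pure algebra) — `g̃ ∈ E_ℓ(P)`, and
   `g = V(snd) ∘ g̃ ∘ V(inl)` lies in the span of the `V(inl ≫ φ ≫ snd)`. Because the tree's
   lattice lemma is the strong (Zarhin) form — *every* stable subspace is realised — neither a
   "nice" prime `ℓ`, nor isotropic subspaces, nor the Frobenius endomorphism (Kieffer,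
   Lemmas 1.2.24–1.2.25; Prop. 1.2.22 "one `ℓ` suffices") is needed, and the reduction
   `Hom` ⇐ `End` of `A × B` (Kieffer, Prop. 1.2.20; Tate, "it suffices to prove `A = B`") is
   built into the graph.
2. **The saturation step** (Tate 1966, §1 Lemma 1 and §2; Kieffer, Prop. 1.2.21) —
   `faltingsTateMap_surjective_of_span_of_saturated`: if moreover the `ℤ_ℓ`-span of the `T_ℓ f`
   is saturated in `Hom_{ℤ_ℓ}(T_ℓ A, T_ℓ B)` (torsion-free cokernel; Milne 1986, Thm. 12.5), the
   Tate map is surjective: for `t` equivariant, `ℚ_ℓ ⊗ t = Σ cᵢ V_ℓ fᵢ`; clearing denominators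
   (`exists_smul_eq_toRational_of_mem_span_rationalTateModuleMap`, `ℚ_ℓ = Frac ℤ_ℓ`) and using
   `T_ℓ B ↪ V_ℓ B` (`TateModule.toRational_injective`), `d • t` lies in the `ℤ_ℓ`-span for some
   `d ≠ 0`, hence so does `t`, and the span is the image of the Tate map
   (`exists_faltingsTateMap_toLinearMap_eq`).
3. **Assembly** — `tate_bijective_of_finite_of_facts A B ℓ`: `tate_bijective_of_finite A B ℓ`
   from the named facts `AbelianVariety.faltingsTateMap_injective A B` (Mumford §19 Thm. 3),
   `AbelianVariety.hasBinaryBiproduct A B`, `AbelianVariety.finite_isoClasses_of_finite K g`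
   (Milne 1986 Cor. 18.9), `AbelianVariety.exists_quotient_isogeny P ℓ`,
   `AbelianVariety.module_free_tateModule P ℓ`, `AbelianVariety.module_finite_tateModule P ℓ`
   (Mumford §19), the proved `AbelianVariety.dim_eq_of_isIsogenous_holds`, and two hypotheses that
   are not (yet) named facts of the tree: semisimplicity of `E_ℓ(P)` (Mumford §19, Cor. 2 of
   Thm. 1, p. 174, via Poincaré's complete reducibility; Kieffer Cor. 1.2.9 and proof of
   Prop. 1.2.26: "since `End(A) ⊗ ℚ_ℓ` is a semisimple `ℚ_ℓ`-algebra"), and the torsion-freeness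
   of the cokernel of `ℤ_ℓ ⊗ Hom_K(A, B) → Hom_{ℤ_ℓ}(T_ℓ A, T_ℓ B)` (Tate 1966 §1 Lemma 1;
   Milne 1986 Thm. 12.5; Kieffer Prop. 1.2.21 via isogeny factorisation, Prop. 1.1.12).

## What is *not* asserted

No named fact is introduced and `tate_bijective_of_finite_holds` is **not** asserted: the facts in
item 3 have no discharge in the tree. `rationalEndSubalgebra P ℓ` is data (a `Subalgebra`), with
carrier the existing span `rationalEndSpanAV P ℓ`; the semisimplicity and saturation inputs are
hypotheses of theorems, spelled with Mathlib notions (`IsSemisimpleRing`, `Submodule.span`).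

## Mathlib

Used: `jacobson_density` and `IsSemisimpleRing.isSemisimpleModule`
(`Mathlib/RingTheory/SimpleModule/Basic.lean`), `Module.compHom`, `Module.Finite.fg_top`,
`LinearMap.ext_on`, `Module.algebraMap_end_apply`, `Subalgebra` (fields) and `Subalgebra.val`,
`Submodule.span_mul_span`, `Submodule.mul_mem_mul`, `IsLocalization.surj` for
`IsFractionRing ℤ_[ℓ] ℚ_[ℓ]`, `Representation.IntertwiningMap.ext/.isIntertwining`,
`CategoryTheory.Limits.BinaryBicone`. From the tree: `rationalTateModuleMap` and its
functoriality, `rationalTateRep_rationalTateModuleMap`, `rationalEndSpanAV`,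
`tateSubspaceRealization`, `exists_binaryBicone_total`, `rationalTateRep_baseChange_of_equivariant`
(`TateAbelianFiniteSteps`); `tateSubspaceRealization_of_finite_of_quotient`
(`TateAbelianFiniteLattice`); `faltingsTateMap_tmul`, `homToTate_apply`,
`toLinearMap_tateIntertwiningMap` (`AVIsogenyTate`); `TateModule.toRational_injective`
(`TateModuleFixedPointsProofs`); `tate_bijective_of_finite_of_injective_of_surjective`
(`TateAbelianFinite`). Mathlib has no double-centraliser theorem for semisimple subalgebras as
such (`lean search 'centralizer_centralizer'`: only the inclusion `le_centralizer_centralizer` and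
the von Neumann bicommutant theorem); the bicommutant form used here is three lines from
`jacobson_density`. The `ℚ_ℓ`-algebra `ℚ_ℓ ⊗_ℤ End_K(P)` itself is avoided: `End P` carries two
`Algebra ℤ` instances in this context (`Ring.toIntAlgebra` and `CategoryTheory.Linear.instAlgebraEnd`
from the preadditive structure), which makes `Semiring (ℚ_[ℓ] ⊗[ℤ] End P)` unsynthesisable
without instance surgery; its image `E_ℓ(P) ⊆ End(V_ℓ P)` is what the proof uses anyway.

## References

* [Tate1966Endomorphisms] J. Tate, *Endomorphisms of abelian varieties over finite fields*,
  Invent. Math. 2 (1966), 134–144: Main Theorem; §1 Lemma 1 (torsion-free cokernel); §2 ("it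
  suffices to prove `A = B`"); §3 (the bicommutant argument). Not held (paywalled, acquisition
  requested); architecture as reported by Kieffer and Milne.
* [Kieffer2024IsogenyGraphs] J. Kieffer, *Isogeny graphs of abelian varieties over finite
  fields* (2024), §1.2.4, pp. 28–32: Prop. 1.2.20, Prop. 1.2.21 (p. 28–29), Prop. 1.2.22,
  Lemma 1.2.23 (p. 30), Lemma 1.2.24 (p. 31, first bullet: `v(W) = v(u(V)) = u(v(V)) ⊆ W`),
  Lemma 1.2.25, Prop. 1.2.26 (p. 32: "by the double centralizer theorem … since
  `End(A) ⊗ ℚ_ℓ` is a semisimple `ℚ_ℓ`-algebra"); Cor. 1.2.9 (p. 24). Held: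
  `paper:galaxy-pdf-6943401066381083540`.
* [Milne2013WorkOfTate] J. S. Milne, *The Work of John Tate*, §4.3.1 (a)–(c) (arXiv:1210.7459,
  pp. 22–23; held).
* [Milne1986AbelianVarieties] J. S. Milne, *Abelian Varieties*, in Cornell–Silverman (eds.),
  *Arithmetic Geometry* (1986), Thm. 12.5 (torsion-free cokernel), Cor. 18.9; held.
* [MumfordAV1970] D. Mumford, *Abelian Varieties*, §19, Thm. 3 and Cor. 2 of Thm. 1 (p. 174),
  Appendix I (as cited; not held).

## Design choices

As in the sibling files: `noncomputable section`, universe-monomorphic `K : Type u`; products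
enter as explicit bicone data `b : BinaryBicone A B` (only the four identities `inl ≫ fst = 𝟙`,
`inl ≫ snd = 0`, `inr ≫ fst = 0`, `inr ≫ snd = 𝟙` are used — not the total identity); the two
pure-algebra lemmas are stated over arbitrary (semi)rings; hypothesis instances `[Finite K]` and
the standing hypothesis `(ℓ : K) ≠ 0` appear only where the lattice lemma is invoked; in the
assembly the facts about the product are quantified over all `P : AbelianVariety K` because the
product object `b.pt` is not nameable by the caller.
-/

noncomputable section

universe u

open CategoryTheory CategoryTheory.Limits
open scoped TensorProduct Pointwise

namespace Literature.AlgebraicGeometry.Motives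

/-! ## Pure algebra: the bicommutant of a semisimple action, and the graph trick -/

section Bicommutant

/-- **Double-centraliser theorem, bicommutant form, via Jacobson density.** Let a semisimple
ring `R` act on a finitely generated `F`-module `V` through an `F`-algebra homomorphism
`θ : R → End_F(V)`. If an `F`-linear `g : V → V` commutes with every `F`-linear map commuting
with `θ(R)`, then `g ∈ θ(R)`. (Mathlib's `jacobson_density`: `V` is a semisimple `R`-module, so
`g`, being `End_R(V)`-linear, agrees with the action of some `r ∈ R` on a finite generating set.)
Kieffer 2024, proof of Prop. 1.2.26 ("by the double centralizer theorem"); Tate 1966, §3.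
[folklore] -/
theorem mem_range_of_forall_commute_of_isSemisimpleRing {F R V : Type*} [CommRing F] [Ring R]
    [Algebra F R] [IsSemisimpleRing R] [AddCommGroup V] [Module F V] [Module.Finite F V]
    (θ : R →ₐ[F] Module.End F V) (g : Module.End F V)
    (hg : ∀ c : Module.End F V, (∀ r : R, c * θ r = θ r * c) → c * g = g * c) :
    g ∈ Set.range θ := by
  classical
  letI : Module R V := Module.compHom V (θ : R →+* Module.End F V)
  have hsmul : ∀ (r : R) (v : V), r • v = θ r v := fun _ _ ↦ rfl
  obtain ⟨s, hs⟩ := Module.Finite.fg_top (R := F) (M := V)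
  -- every `R`-linear endomorphism is `F`-linear and commutes with `θ(R)`, hence with `g`
  have key : ∀ (c : Module.End R V) (v : V), g (c v) = c (g v) := by
    intro c v
    have hF : ∀ (t : F) (w : V), c (t • w) = t • c w := by
      intro t w
      have h1 : ∀ w : V, (algebraMap F R t) • w = t • w := fun w ↦ by
        rw [hsmul, θ.commutes, Module.algebraMap_end_apply]
      rw [← h1, LinearMap.map_smul, h1]
    let c' : Module.End F V :=
      { toFun := c, map_add' := c.map_add, map_smul' := hF }
    have hc' : ∀ r : R, c' * θ r = θ r * c' := fun r ↦ by
      refine LinearMap.ext fun w ↦ ?_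
      change c (θ r w) = θ r (c w)
      rw [← hsmul, ← hsmul, LinearMap.map_smul]
    exact (LinearMap.congr_fun (hg c' hc') v).symm
  let f : Module.End (Module.End R V) V :=
    { toFun := g, map_add' := g.map_add, map_smul' := fun c v ↦ key c v }
  obtain ⟨r, hr⟩ := jacobson_density f s
  exact ⟨r, LinearMap.ext_on hs fun m hm ↦ (hr m hm).symm⟩

variable {R : Type*} [Semiring R] {VA VB VP : Type*} [AddCommMonoid VA] [Module R VA]
  [AddCommMonoid VB] [Module R VB] [AddCommMonoid VP] [Module R VP]

/-- **The graph trick** (Tate 1966, §3; Kieffer 2024, proof of Lemma 1.2.24, first bullet: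
`v(W) = v(u(V)) = u(v(V)) ⊆ W`), as pure linear algebra. Let `fst, snd, inl, inr` exhibit
`VA ⊕ VB` inside `VP` (`fst ∘ inl = id`, `snd ∘ inl = 0`, `fst ∘ inr = 0`, `snd ∘ inr = id`), let
`g : VA → VB`, and put `g̃ = inr ∘ g ∘ fst`, so that the graph of `g` is the range of
`inl ∘ fst + g̃`. If `d : VP → VP` commutes with the two idempotents `inl ∘ fst`, `inr ∘ snd` and
maps the graph into itself, then `d` commutes with `g̃`. [folklore] -/
theorem comp_graphMap_eq_of_mapsTo (fst : VP →ₗ[R] VA) (snd : VP →ₗ[R] VB) (inl : VA →ₗ[R] VP)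
    (inr : VB →ₗ[R] VP) (inl_fst : fst ∘ₗ inl = LinearMap.id) (inl_snd : snd ∘ₗ inl = 0)
    (inr_fst : fst ∘ₗ inr = 0) (inr_snd : snd ∘ₗ inr = LinearMap.id)
    (g : VA →ₗ[R] VB) (d : VP →ₗ[R] VP)
    (h₁ : d ∘ₗ (inl ∘ₗ fst) = (inl ∘ₗ fst) ∘ₗ d) (h₂ : d ∘ₗ (inr ∘ₗ snd) = (inr ∘ₗ snd) ∘ₗ d)
    (hW : ∀ w : VP, ∃ w' : VP,
      d ((inl ∘ₗ fst + inr ∘ₗ g ∘ₗ fst) w) = (inl ∘ₗ fst + inr ∘ₗ g ∘ₗ fst) w') :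
    d ∘ₗ (inr ∘ₗ g ∘ₗ fst) = (inr ∘ₗ g ∘ₗ fst) ∘ₗ d := by
  have e1 : ∀ x, fst (inl x) = x := fun x ↦ LinearMap.congr_fun inl_fst x
  have e2 : ∀ x, snd (inl x) = 0 := fun x ↦ LinearMap.congr_fun inl_snd x
  have e3 : ∀ y, fst (inr y) = 0 := fun y ↦ LinearMap.congr_fun inr_fst y
  have e4 : ∀ y, snd (inr y) = y := fun y ↦ LinearMap.congr_fun inr_snd y
  have d1 : ∀ w, d (inl (fst w)) = inl (fst (d w)) := fun w ↦ LinearMap.congr_fun h₁ w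
  have d2 : ∀ w, d (inr (snd w)) = inr (snd (d w)) := fun w ↦ LinearMap.congr_fun h₂ w
  -- `d ∘ inr ∘ g ∘ fst = inr ∘ snd ∘ d ∘ inr ∘ g ∘ fst` (insert the idempotent `inr ∘ snd`)
  have d3 : ∀ w, d (inr (g (fst w))) = inr (snd (d (inr (g (fst w))))) := fun w ↦ by
    have := d2 (inr (g (fst w)))
    rwa [e4] at this
  refine LinearMap.ext fun w ↦ ?_
  obtain ⟨w', hw'⟩ := hW w
  simp only [LinearMap.add_apply, LinearMap.comp_apply, map_add] at hw' ⊢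
  -- `hw' : d (inl (fst w)) + d (inr (g (fst w))) = inl (fst w') + inr (g (fst w'))`
  -- apply `fst`: `fst (d w) = fst w'`
  have hA : fst (d w) = fst w' := by
    have h := congrArg fst hw'
    rw [map_add, map_add, d1, e1, d3, e3, add_zero, e1, e3, add_zero] at h
    exact h
  -- apply `snd`: `snd (d (inr (g (fst w)))) = g (fst w')`
  have hB : snd (d (inr (g (fst w)))) = g (fst w') := by
    have h := congrArg snd hw'
    rw [map_add, map_add, d1, e2, zero_add, d3, e4, e2, e4, zero_add] at h
    exact h
  rw [d3, hB, hA]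

end Bicommutant

/-! ## `E_ℓ(P)` as a subalgebra of `End_{ℚ_ℓ}(V_ℓ P)` -/

namespace AbelianVariety

variable {K : Type u} [Field K] (P : AbelianVariety K) (ℓ : ℕ) [Fact ℓ.Prime]

/-- `V_ℓ` on endomorphisms as a ring homomorphism `End_K(P) → End_{ℚ_ℓ}(V_ℓ P)`, `φ ↦ V_ℓ φ`
(multiplicative because multiplication in `End P` is `φ * ψ = ψ ≫ φ`, Mathlib `End.mul_def`, and
`V_ℓ (ψ ≫ φ) = V_ℓ φ ∘ V_ℓ ψ`). Tate 1966, §1 (`E → End V_ℓ(A)`); Kieffer 2024, §1.2.2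
(`V_ℓ : End(A) → End(V_ℓ(A))`). [folklore] -/
def rationalTateEndRingHom : End P →+* Module.End ℚ_[ℓ] (P.rationalTateModule ℓ) where
  toFun φ := rationalTateModuleMap ℓ φ
  map_one' := rationalTateModuleMap_id ℓ P
  map_mul' φ ψ := by
    change rationalTateModuleMap ℓ (ψ ≫ φ) = _
    rw [rationalTateModuleMap_comp]
    rfl
  map_zero' := rationalTateModuleMap_zero ℓ
  map_add' := rationalTateModuleMap_add ℓ

/-- `rationalTateEndRingHom P ℓ φ = V_ℓ φ`. [folklore] -/
@[simp]
theorem rationalTateEndRingHom_apply (φ : End P) :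
    rationalTateEndRingHom P ℓ φ = rationalTateModuleMap ℓ φ := rfl

/-- The set of the `V_ℓ φ`, `φ ∈ End_K(P)`, is closed under multiplication:
`V_ℓ φ * V_ℓ ψ = V_ℓ (ψ ≫ φ)`. [folklore] -/
theorem range_rationalTateModuleMap_mul_subset :
    (Set.range fun φ : P ⟶ P ↦
        (rationalTateModuleMap ℓ φ : Module.End ℚ_[ℓ] (P.rationalTateModule ℓ))) *
      (Set.range fun φ : P ⟶ P ↦
        (rationalTateModuleMap ℓ φ : Module.End ℚ_[ℓ] (P.rationalTateModule ℓ))) ⊆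
    Set.range fun φ : P ⟶ P ↦
        (rationalTateModuleMap ℓ φ : Module.End ℚ_[ℓ] (P.rationalTateModule ℓ)) := by
  rintro _ ⟨_, ⟨φ, rfl⟩, _, ⟨ψ, rfl⟩, rfl⟩
  exact ⟨ψ ≫ φ, (rationalTateEndRingHom P ℓ).map_mul φ ψ⟩

/-- **`E_ℓ(P)` as a `ℚ_ℓ`-subalgebra of `End_{ℚ_ℓ}(V_ℓ P)`**: the `ℚ_ℓ`-span
`rationalEndSpanAV P ℓ` of the `V_ℓ φ`, `φ ∈ End_K(P)`, is closed under composition and contains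
`1 = V_ℓ (𝟙 P)`, so it is the image of the `ℚ_ℓ`-algebra `ℚ_ℓ ⊗ End_K(P)` under
`c ⊗ φ ↦ c • V_ℓ φ` (Tate 1966, §1–§2: `E_ℓ = E ⊗ ℚ_ℓ`, identified with a subalgebra of
`End V_ℓ(A)` by the injectivity of the Tate map; Kieffer 2024, §1.2.4: `V_ℓ(End(A) ⊗ ℚ_ℓ)`).
[folklore] -/
def rationalEndSubalgebra : Subalgebra ℚ_[ℓ] (Module.End ℚ_[ℓ] (P.rationalTateModule ℓ)) where
  carrier := rationalEndSpanAV P ℓ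
  mul_mem' {x y} hx hy := by
    have hx' : x ∈ rationalEndSpanAV P ℓ := hx
    have hy' : y ∈ rationalEndSpanAV P ℓ := hy
    change x * y ∈ rationalEndSpanAV P ℓ
    rw [rationalEndSpanAV_def] at hx' hy' ⊢
    have h := Submodule.mul_mem_mul hx' hy'
    rw [Submodule.span_mul_span] at h
    exact Submodule.span_mono (range_rationalTateModuleMap_mul_subset P ℓ) h
  one_mem' := by
    change (1 : Module.End ℚ_[ℓ] (P.rationalTateModule ℓ)) ∈ rationalEndSpanAV P ℓ
    rw [← (rationalTateEndRingHom P ℓ).map_one]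
    exact rationalTateModuleMap_mem_rationalEndSpanAV P ℓ _
  add_mem' hx hy := Submodule.add_mem _ hx hy
  zero_mem' := Submodule.zero_mem _
  algebraMap_mem' c := by
    change algebraMap ℚ_[ℓ] _ c ∈ rationalEndSpanAV P ℓ
    rw [Algebra.algebraMap_eq_smul_one, ← (rationalTateEndRingHom P ℓ).map_one]
    exact Submodule.smul_mem _ c (rationalTateModuleMap_mem_rationalEndSpanAV P ℓ _)

/-- Membership in `rationalEndSubalgebra P ℓ` is membership in the span `rationalEndSpanAV P ℓ`
(`Iff.rfl`). [folklore] -/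
theorem mem_rationalEndSubalgebra_iff (x : Module.End ℚ_[ℓ] (P.rationalTateModule ℓ)) :
    x ∈ rationalEndSubalgebra P ℓ ↔ x ∈ rationalEndSpanAV P ℓ :=
  Iff.rfl

/-- `E_ℓ(P)` as a subalgebra and as a span have the same underlying set (`rfl`). [folklore] -/
theorem coe_rationalEndSubalgebra :
    (rationalEndSubalgebra P ℓ : Set (Module.End ℚ_[ℓ] (P.rationalTateModule ℓ))) =
      rationalEndSpanAV P ℓ :=
  rfl

end AbelianVariety

/-! ## The double-centraliser step: from the lattice lemma to `ℚ_ℓ ⊗ Hom ↠ Hom_Γ(V_ℓ A, V_ℓ B)` -/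

section Centralizer

open AbelianVariety

variable {K : Type u} [Field K] {A B : AbelianVariety K} (ℓ : ℕ) [Fact ℓ.Prime]

/-- **Tate's Main Theorem at the `ℚ_ℓ`-level, from the lattice lemma and semisimplicity**
(the double-centraliser step of Tate's proof; Tate 1966, §3; Kieffer 2024, Prop. 1.2.26 with
the first bullet of Lemma 1.2.24; Milne, *The Work of John Tate*, §4.3.1 (c)). Let `b` be a
bicone on `(A, B)` (the product abelian variety `P = A × B` with its structure maps), and assume
(i) the lattice lemma for `P` in its strong form `tateSubspaceRealization P ℓ` (every
`Γ_K`-stable `ℚ_ℓ`-subspace of `V_ℓ P` is `u(V_ℓ P)` with `u ∈ E_ℓ(P)`), (ii) the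
`ℚ_ℓ`-algebra `E_ℓ(P)` (`rationalEndSubalgebra P ℓ`, the image of `ℚ_ℓ ⊗ End_K(P)`) is
semisimple, (iii) `T_ℓ P` is finitely generated. Then every `Γ_K`-equivariant `ℚ_ℓ`-linear
map `g : V_ℓ A → V_ℓ B` lies in the `ℚ_ℓ`-span of the `V_ℓ f`, `f ∈ Hom_K(A, B)`. Proof: the
graph `W` of `g` is `Γ_K`-stable, hence `W = u(V_ℓ P)` with `u ∈ E_ℓ(P)`; every `d` in the
centraliser `D` of `E_ℓ(P)` then maps `W` into itself, so commutes with `g̃ = V(inr) g V(fst)`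
(`comp_graphMap_eq_of_mapsTo`); by the double-centraliser theorem
(`mem_range_of_forall_commute_of_isSemisimpleRing`) `g̃ ∈ E_ℓ(P)`, and
`g = V(snd) g̃ V(inl)`. Because (i) is the strong (Zarhin) form of the lattice lemma, neither a
"nice" prime `ℓ` nor the Frobenius endomorphism (Kieffer, Lemmas 1.2.24–1.2.25) is needed.
[cite: Kieffer2024IsogenyGraphs, Prop. 1.2.26] -/
theorem mem_span_rationalTateModuleMap_of_tateSubspaceRealization (b : BinaryBicone A B)
    (hW : tateSubspaceRealization b.pt ℓ)
    (hss : IsSemisimpleRing (rationalEndSubalgebra b.pt ℓ))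
    (hfinT : module_finite_tateModule b.pt ℓ)
    (g : A.rationalTateModule ℓ →ₗ[ℚ_[ℓ]] B.rationalTateModule ℓ)
    (hg : ∀ (σ : Field.absoluteGaloisGroup K) (v : A.rationalTateModule ℓ),
      g (A.rationalTateRep ℓ σ v) = B.rationalTateRep ℓ σ (g v)) :
    g ∈ Submodule.span ℚ_[ℓ] (Set.range (rationalTateModuleMap ℓ : (A ⟶ B) → _)) := by
  haveI : Module.Finite ℤ_[ℓ] (b.pt.tateModule ℓ) := hfinT
  haveI : Module.Finite ℚ_[ℓ] (b.pt.rationalTateModule ℓ) :=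
    inferInstanceAs (Module.Finite ℚ_[ℓ] (ℚ_[ℓ] ⊗[ℤ_[ℓ]] b.pt.tateModule ℓ))
  haveI := hss
  -- the four structure maps of `V_ℓ(b.pt) ⊇ V_ℓ A ⊕ V_ℓ B` and their identities
  set Fst := rationalTateModuleMap ℓ b.fst with hFst
  set Snd := rationalTateModuleMap ℓ b.snd with hSnd
  set Inl := rationalTateModuleMap ℓ b.inl with hInl
  set Inr := rationalTateModuleMap ℓ b.inr with hInr
  have inl_fst : Fst ∘ₗ Inl = LinearMap.id := by
    rw [hFst, hInl, ← rationalTateModuleMap_comp, b.inl_fst, rationalTateModuleMap_id]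
  have inr_fst : Fst ∘ₗ Inr = 0 := by
    rw [hFst, hInr, ← rationalTateModuleMap_comp, b.inr_fst, rationalTateModuleMap_zero]
  have inl_snd : Snd ∘ₗ Inl = 0 := by
    rw [hSnd, hInl, ← rationalTateModuleMap_comp, b.inl_snd, rationalTateModuleMap_zero]
  have inr_snd : Snd ∘ₗ Inr = LinearMap.id := by
    rw [hSnd, hInr, ← rationalTateModuleMap_comp, b.inr_snd, rationalTateModuleMap_id]
  -- `E_ℓ(b.pt)` and its inclusion `θ` into `End(V_ℓ b.pt)`
  set E := rationalEndSubalgebra b.pt ℓ with hE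
  set θ : E →ₐ[ℚ_[ℓ]] Module.End ℚ_[ℓ] (b.pt.rationalTateModule ℓ) := E.val with hθ
  have hp₁ : Inl ∘ₗ Fst ∈ E := by
    rw [hInl, hFst, ← rationalTateModuleMap_comp]
    exact rationalTateModuleMap_mem_rationalEndSpanAV b.pt ℓ _
  have hp₂ : Inr ∘ₗ Snd ∈ E := by
    rw [hInr, hSnd, ← rationalTateModuleMap_comp]
    exact rationalTateModuleMap_mem_rationalEndSpanAV b.pt ℓ _
  -- the graph of `g`, a `Γ_K`-stable subspace of `V_ℓ(b.pt)`, is `u (V_ℓ b.pt)`, `u ∈ E`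
  set gt : Module.End ℚ_[ℓ] (b.pt.rationalTateModule ℓ) := Inr ∘ₗ g ∘ₗ Fst with hgt
  set W : Submodule ℚ_[ℓ] (b.pt.rationalTateModule ℓ) := LinearMap.range (Inl ∘ₗ Fst + gt)
    with hWdef
  have hstab : ∀ (σ : Field.absoluteGaloisGroup K) (v : b.pt.rationalTateModule ℓ),
      v ∈ W → b.pt.rationalTateRep ℓ σ v ∈ W := by
    rintro σ _ ⟨x, rfl⟩
    refine ⟨b.pt.rationalTateRep ℓ σ x, ?_⟩
    simp only [hgt, hInl, hInr, hFst, LinearMap.add_apply, LinearMap.comp_apply, map_add,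
      rationalTateRep_rationalTateModuleMap, hg]
  obtain ⟨u, hu, hru⟩ := hW W hstab
  -- `g̃` commutes with the centraliser of `E`
  have hcomm : ∀ c : Module.End ℚ_[ℓ] (b.pt.rationalTateModule ℓ),
      (∀ r : E, c * θ r = θ r * c) → c * gt = gt * c := by
    intro c hc
    refine comp_graphMap_eq_of_mapsTo Fst Snd Inl Inr inl_fst inl_snd inr_fst inr_snd g c
      (hc ⟨_, hp₁⟩) (hc ⟨_, hp₂⟩) fun w ↦ ?_
    obtain ⟨v, hv⟩ : (Inl ∘ₗ Fst + gt) w ∈ LinearMap.range u := by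
      rw [hru]; exact ⟨w, rfl⟩
    obtain ⟨w', hw'⟩ : u (c v) ∈ W := by rw [← hru]; exact ⟨c v, rfl⟩
    refine ⟨w', ?_⟩
    change c ((Inl ∘ₗ Fst + gt) w) = (Inl ∘ₗ Fst + gt) w'
    rw [hw', ← hv]
    exact LinearMap.congr_fun (hc ⟨u, hu⟩) v
  obtain ⟨r, hr⟩ := mem_range_of_forall_commute_of_isSemisimpleRing θ gt hcomm
  -- `g = V(snd) ∘ g̃ ∘ V(inl)` and `g̃ = θ r ∈ E_ℓ(b.pt)`
  have hg' : g = Snd ∘ₗ gt ∘ₗ Inl := by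
    rw [hgt, ← LinearMap.comp_assoc, ← LinearMap.comp_assoc, inr_snd, LinearMap.id_comp,
      LinearMap.comp_assoc, inl_fst, LinearMap.comp_id]
  have hmem : gt ∈ rationalEndSpanAV b.pt ℓ := by
    rw [← hr]
    exact r.2
  rw [hg']
  rw [rationalEndSpanAV_def] at hmem
  refine Submodule.span_induction ?_ ?_ ?_ ?_ hmem
  · rintro _ ⟨φ, rfl⟩
    refine Submodule.subset_span ⟨b.inl ≫ φ ≫ b.snd, ?_⟩
    rw [rationalTateModuleMap_comp, rationalTateModuleMap_comp, hSnd, hInl, LinearMap.comp_assoc]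
  · rw [LinearMap.zero_comp, LinearMap.comp_zero]
    exact Submodule.zero_mem _
  · intro x y _ _ hx hy
    rw [LinearMap.add_comp, LinearMap.comp_add]
    exact Submodule.add_mem _ hx hy
  · intro c x _ hx
    rw [LinearMap.smul_comp, LinearMap.comp_smul]
    exact Submodule.smul_mem _ c hx

/-- **The `ℚ_ℓ`-level Main Theorem over a finite field, from the named facts.** For `K` finite,
`(ℓ : K) ≠ 0` and a bicone `b` on `(A, B)`: granted the finiteness of `K`-isomorphism classes of
abelian varieties of dimension `dim b.pt` (`hfin`, Milne 1986 Cor. 18.9), the quotient fact for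
`b.pt` (`hq`), `T_ℓ b.pt` free of finite rank (`hfree`, `hfinT`) — which give the lattice lemma
`tateSubspaceRealization b.pt ℓ` (`tateSubspaceRealization_of_finite_of_quotient`, with
`dim_eq_of_isIsogenous_holds`) — and the semisimplicity of `E_ℓ(b.pt)` (`hss`), every
`Γ_K`-equivariant `ℚ_ℓ`-linear `g : V_ℓ A → V_ℓ B` lies in the `ℚ_ℓ`-span of the `V_ℓ f`,
`f ∈ Hom_K(A, B)` (Tate 1966, Main Theorem ⊗ ℚ_ℓ; Kieffer 2024, Prop. 1.2.26 for `A × B` with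
Prop. 1.2.20). [cite: Kieffer2024IsogenyGraphs, Prop. 1.2.26 and Prop. 1.2.20] -/
theorem mem_span_rationalTateModuleMap_of_finite [Finite K] (hℓ : (ℓ : K) ≠ 0)
    (b : BinaryBicone A B) (hfin : finite_isoClasses_of_finite K b.pt.dim)
    (hq : exists_quotient_isogeny b.pt ℓ) (hfree : module_free_tateModule b.pt ℓ)
    (hfinT : module_finite_tateModule b.pt ℓ)
    (hss : IsSemisimpleRing (rationalEndSubalgebra b.pt ℓ))
    (g : A.rationalTateModule ℓ →ₗ[ℚ_[ℓ]] B.rationalTateModule ℓ)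
    (hg : ∀ (σ : Field.absoluteGaloisGroup K) (v : A.rationalTateModule ℓ),
      g (A.rationalTateRep ℓ σ v) = B.rationalTateRep ℓ σ (g v)) :
    g ∈ Submodule.span ℚ_[ℓ] (Set.range (rationalTateModuleMap ℓ : (A ⟶ B) → _)) :=
  mem_span_rationalTateModuleMap_of_tateSubspaceRealization ℓ b
    (tateSubspaceRealization_of_finite_of_quotient b.pt ℓ hℓ hfin hq
      (fun _ ↦ dim_eq_of_isIsogenous_holds) hfree hfinT) hss hfinT g hg

end Centralizer

/-! ## The saturation step: from `ℚ_ℓ ⊗ Hom ↠ Hom_Γ(V_ℓ A, V_ℓ B)` to the Tate map over `ℤ_ℓ` -/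

section Integral

open AbelianVariety Literature.NumberTheory.EllipticCurves

variable {K : Type u} [Field K] {A B : AbelianVariety K} (ℓ : ℕ) [Fact ℓ.Prime]

/-- **Clearing denominators.** An element `x` of the `ℚ_ℓ`-span of the `V_ℓ f`, `f ∈ Hom_K(A, B)`,
satisfies `d • x ∘ ι = ι ∘ y` for some non-zero `d ∈ ℤ_ℓ` and some `y` in the `ℤ_ℓ`-span of the
`T_ℓ f`, where `ι : T_ℓ ↪ V_ℓ` (`TateModule.toRational`). Induction on the span; the scalar case
writes `c ∈ ℚ_ℓ` as `a / e` with `a, e ∈ ℤ_ℓ` (`ℚ_ℓ = Frac ℤ_ℓ`, Mathlib `IsLocalization.surj`).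
Kieffer 2024, proof of Prop. 1.2.21 ("approximating the coefficients `λ_i` by integers").
[folklore] -/
theorem exists_smul_eq_toRational_of_mem_span_rationalTateModuleMap
    {x : A.rationalTateModule ℓ →ₗ[ℚ_[ℓ]] B.rationalTateModule ℓ}
    (hx : x ∈ Submodule.span ℚ_[ℓ] (Set.range (rationalTateModuleMap ℓ : (A ⟶ B) → _))) :
    ∃ d : ℤ_[ℓ], d ≠ 0 ∧
      ∃ y ∈ Submodule.span ℤ_[ℓ] (Set.range (tateModuleMap ℓ : (A ⟶ B) → _)),
        ∀ v : A.tateModule ℓ, algebraMap ℤ_[ℓ] ℚ_[ℓ] d • x (TateModule.toRational ℓ v) =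
          TateModule.toRational ℓ (y v) := by
  induction hx using Submodule.span_induction with
  | mem x hx =>
    obtain ⟨f, rfl⟩ := hx
    refine ⟨1, one_ne_zero, tateModuleMap ℓ f, Submodule.subset_span ⟨f, rfl⟩, fun v ↦ ?_⟩
    rw [map_one, one_smul, rationalTateModuleMap_toRational]
  | zero =>
    refine ⟨1, one_ne_zero, 0, Submodule.zero_mem _, fun v ↦ ?_⟩
    rw [LinearMap.zero_apply, LinearMap.zero_apply, smul_zero, map_zero]
  | add x x' _ _ hx hx' =>
    obtain ⟨d, hd, y, hy, h⟩ := hx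
    obtain ⟨d', hd', y', hy', h'⟩ := hx'
    refine ⟨d * d', mul_ne_zero hd hd', d' • y + d • y',
      Submodule.add_mem _ (Submodule.smul_mem _ _ hy) (Submodule.smul_mem _ _ hy'), fun v ↦ ?_⟩
    calc algebraMap ℤ_[ℓ] ℚ_[ℓ] (d * d') • (x + x') (TateModule.toRational ℓ v)
        = algebraMap ℤ_[ℓ] ℚ_[ℓ] d' • (algebraMap ℤ_[ℓ] ℚ_[ℓ] d • x (TateModule.toRational ℓ v)) +
          algebraMap ℤ_[ℓ] ℚ_[ℓ] d • (algebraMap ℤ_[ℓ] ℚ_[ℓ] d' • x' (TateModule.toRational ℓ v)) := by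
          rw [LinearMap.add_apply, smul_add, map_mul, mul_smul, mul_smul,
            smul_comm (algebraMap ℤ_[ℓ] ℚ_[ℓ] d) (algebraMap ℤ_[ℓ] ℚ_[ℓ] d')
              (x (TateModule.toRational ℓ v))]
      _ = TateModule.toRational ℓ ((d' • y + d • y') v) := by
          rw [h v, h' v, algebraMap_smul, algebraMap_smul, LinearMap.add_apply,
            LinearMap.smul_apply, LinearMap.smul_apply, map_add, LinearMap.map_smul,
            LinearMap.map_smul]
  | smul c x _ hx =>
    obtain ⟨d, hd, y, hy, h⟩ := hx
    obtain ⟨⟨a, e⟩, hae⟩ := IsLocalization.surj (nonZeroDivisors ℤ_[ℓ]) c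
    refine ⟨e * d, mul_ne_zero (nonZeroDivisors.ne_zero e.2) hd, a • y,
      Submodule.smul_mem _ _ hy, fun v ↦ ?_⟩
    calc algebraMap ℤ_[ℓ] ℚ_[ℓ] (e * d) • (c • x) (TateModule.toRational ℓ v)
        = (algebraMap ℤ_[ℓ] ℚ_[ℓ] a * algebraMap ℤ_[ℓ] ℚ_[ℓ] d) • x (TateModule.toRational ℓ v) := by
          rw [LinearMap.smul_apply, smul_smul, map_mul, ← hae]
          congr 1
          ring
      _ = TateModule.toRational ℓ ((a • y) v) := by
          rw [mul_smul, h v, algebraMap_smul, LinearMap.smul_apply, LinearMap.map_smul]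

/-- Every element of the `ℤ_ℓ`-span of the `T_ℓ f`, `f ∈ Hom_K(A, B)`, is the underlying linear map
of an element of the image of the Tate map `ℤ_ℓ ⊗ Hom_K(A, B) → Hom_{Γ_K}(T_ℓ A, T_ℓ B)`
(`T_ℓ f = faltingsTateMap (1 ⊗ f)`; converse of `toLinearMap_mem_span_of_mem_range`).
[folklore] -/
theorem exists_faltingsTateMap_toLinearMap_eq {y : A.tateModule ℓ →ₗ[ℤ_[ℓ]] B.tateModule ℓ}
    (hy : y ∈ Submodule.span ℤ_[ℓ] (Set.range (tateModuleMap ℓ : (A ⟶ B) → _))) :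
    ∃ z : ℤ_[ℓ] ⊗[ℤ] (A ⟶ B), (faltingsTateMap A B ℓ z).toLinearMap = y := by
  induction hy using Submodule.span_induction with
  | mem y hy =>
    obtain ⟨f, rfl⟩ := hy
    exact ⟨1 ⊗ₜ[ℤ] f, by
      rw [faltingsTateMap_tmul, one_smul, homToTate_apply, toLinearMap_tateIntertwiningMap]⟩
  | zero => exact ⟨0, by rw [map_zero, Representation.IntertwiningMap.zero_toLinearMap]⟩
  | add y y' _ _ hy hy' =>
    obtain ⟨z, hz⟩ := hy
    obtain ⟨z', hz'⟩ := hy'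
    exact ⟨z + z', by rw [map_add, Representation.IntertwiningMap.add_toLinearMap, hz, hz']⟩
  | smul c y _ hy =>
    obtain ⟨z, hz⟩ := hy
    exact ⟨c • z, by rw [map_smul, Representation.IntertwiningMap.toLinearMap_smul, hz]⟩

/-- **The saturation step** (Tate 1966, §1, Lemma 1 and §2; Kieffer 2024, Prop. 1.2.21:
"what we have to show is that `T_ℓ : End(A) → End(T_ℓ A)` has torsion-free cokernel"). If every
`Γ_K`-equivariant `ℚ_ℓ`-linear `V_ℓ A → V_ℓ B` lies in the `ℚ_ℓ`-span of the `V_ℓ f` (`hspan`,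
the `ℚ_ℓ`-level Main Theorem) and the `ℤ_ℓ`-span of the `T_ℓ f` is saturated in
`Hom_{ℤ_ℓ}(T_ℓ A, T_ℓ B)` (`hsat`: torsion-free cokernel, Milne 1986 Thm. 12.5), then the Tate
map `ℤ_ℓ ⊗ Hom_K(A, B) → Hom_{Γ_K}(T_ℓ A, T_ℓ B)` is surjective: for `t` equivariant,
`ℚ_ℓ ⊗ t = Σ cᵢ V_ℓ fᵢ`, so `d • t` lies in the `ℤ_ℓ`-span for some `d ≠ 0` (clearing
denominators and `T_ℓ B ↪ V_ℓ B`), hence so does `t`. [cite: Kieffer2024IsogenyGraphs, Prop. 1.2.21] -/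
theorem faltingsTateMap_surjective_of_span_of_saturated
    (hspan : ∀ g : A.rationalTateModule ℓ →ₗ[ℚ_[ℓ]] B.rationalTateModule ℓ,
      (∀ (σ : Field.absoluteGaloisGroup K) (v : A.rationalTateModule ℓ),
        g (A.rationalTateRep ℓ σ v) = B.rationalTateRep ℓ σ (g v)) →
      g ∈ Submodule.span ℚ_[ℓ] (Set.range (rationalTateModuleMap ℓ : (A ⟶ B) → _)))
    (hsat : ∀ (t : A.tateModule ℓ →ₗ[ℤ_[ℓ]] B.tateModule ℓ) (d : ℤ_[ℓ]), d ≠ 0 →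
      d • t ∈ Submodule.span ℤ_[ℓ] (Set.range (tateModuleMap ℓ : (A ⟶ B) → _)) →
      t ∈ Submodule.span ℤ_[ℓ] (Set.range (tateModuleMap ℓ : (A ⟶ B) → _))) :
    Function.Surjective (faltingsTateMap A B ℓ) := by
  intro t
  set g : A.tateModule ℓ →ₗ[ℤ_[ℓ]] B.tateModule ℓ := t.toLinearMap with hgdef
  have hg : ∀ (σ : Field.absoluteGaloisGroup K) (x : A.tateModule ℓ), g (σ • x) = σ • g x :=
    fun σ x ↦ t.isIntertwining _ _ σ x
  obtain ⟨d, hd, y, hy, h⟩ := exists_smul_eq_toRational_of_mem_span_rationalTateModuleMap ℓ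
    (hspan _ (rationalTateRep_baseChange_of_equivariant ℓ g hg))
  have hdy : d • g = y := by
    refine LinearMap.ext fun v ↦ TateModule.toRational_injective ?_
    rw [← h v, LinearMap.smul_apply, LinearMap.map_smul, algebraMap_smul]
    rfl
  obtain ⟨z, hz⟩ := exists_faltingsTateMap_toLinearMap_eq ℓ (hsat g d hd (hdy ▸ hy))
  exact ⟨z, Representation.IntertwiningMap.ext hz⟩

/-- **Surjectivity of the Tate map over a finite field, from the named facts** (Tate 1966, Main
Theorem, surjectivity half): `K` finite, `(ℓ : K) ≠ 0`, `b` a bicone on `(A, B)`; inputs as in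
`mem_span_rationalTateModuleMap_of_finite` plus the saturation hypothesis `hsat` of
`faltingsTateMap_surjective_of_span_of_saturated`. [cite: Kieffer2024IsogenyGraphs, Prop. 1.2.20–1.2.21 and Prop. 1.2.26] -/
theorem faltingsTateMap_surjective_of_finite [Finite K] (hℓ : (ℓ : K) ≠ 0)
    (b : BinaryBicone A B) (hfin : finite_isoClasses_of_finite K b.pt.dim)
    (hq : exists_quotient_isogeny b.pt ℓ) (hfree : module_free_tateModule b.pt ℓ)
    (hfinT : module_finite_tateModule b.pt ℓ)
    (hss : IsSemisimpleRing (rationalEndSubalgebra b.pt ℓ))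
    (hsat : ∀ (t : A.tateModule ℓ →ₗ[ℤ_[ℓ]] B.tateModule ℓ) (d : ℤ_[ℓ]), d ≠ 0 →
      d • t ∈ Submodule.span ℤ_[ℓ] (Set.range (tateModuleMap ℓ : (A ⟶ B) → _)) →
      t ∈ Submodule.span ℤ_[ℓ] (Set.range (tateModuleMap ℓ : (A ⟶ B) → _))) :
    Function.Surjective (faltingsTateMap A B ℓ) :=
  faltingsTateMap_surjective_of_span_of_saturated ℓ
    (mem_span_rationalTateModuleMap_of_finite ℓ hℓ b hfin hq hfree hfinT hss) hsat

variable (A B) in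
/-- **Tate's Main Theorem reduced to named facts of the theory of abelian varieties** (Tate,
Invent. Math. 2 (1966), Main Theorem; architecture of Kieffer 2024, §1.2.4 and Milne, *The Work
of John Tate*, §4.3.1). `tate_bijective_of_finite A B ℓ` follows from: injectivity of the Tate
map (`hinj`, Mumford §19 Thm. 3), products of abelian varieties (`hprod`), finiteness of
`K`-isomorphism classes over a finite `K` (`hfin`, Milne 1986 Cor. 18.9), quotients by finite
`Γ_K`-stable subgroups (`hq`), `T_ℓ P` free of finite rank (`hfree`, `hfinT`, Mumford §19),
semisimplicity of `E_ℓ(P) ≅ ℚ_ℓ ⊗ End_K(P)` (`hss`, Mumford §19 Cor. 2 of Thm. 1 with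
Poincaré's complete reducibility; Kieffer Cor. 1.2.9) and the torsion-freeness of the cokernel
of `ℤ_ℓ ⊗ Hom_K(A, B) → Hom_{ℤ_ℓ}(T_ℓ A, T_ℓ B)` (`hsat`, Tate 1966 §1 Lemma 1; Milne 1986
Thm. 12.5). The discharge `tate_bijective_of_finite_holds` is this theorem applied to the
`_holds` of those facts, none of which is asserted here. [cite: Tate1966Endomorphisms, Main Theorem] -/
theorem tate_bijective_of_finite_of_facts (hinj : faltingsTateMap_injective A B)
    (hprod : hasBinaryBiproduct A B) (hfin : ∀ g : ℕ, finite_isoClasses_of_finite K g)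
    (hq : ∀ P : AbelianVariety K, exists_quotient_isogeny P ℓ)
    (hfree : ∀ P : AbelianVariety K, module_free_tateModule P ℓ)
    (hfinT : ∀ P : AbelianVariety K, module_finite_tateModule P ℓ)
    (hss : ∀ P : AbelianVariety K, IsSemisimpleRing (rationalEndSubalgebra P ℓ))
    (hsat : (ℓ : K) ≠ 0 → ∀ (t : A.tateModule ℓ →ₗ[ℤ_[ℓ]] B.tateModule ℓ) (d : ℤ_[ℓ]), d ≠ 0 →
      d • t ∈ Submodule.span ℤ_[ℓ] (Set.range (tateModuleMap ℓ : (A ⟶ B) → _)) →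
      t ∈ Submodule.span ℤ_[ℓ] (Set.range (tateModuleMap ℓ : (A ⟶ B) → _))) :
    tate_bijective_of_finite A B ℓ := by
  refine tate_bijective_of_finite_of_injective_of_surjective A B ℓ hinj fun hℓ ↦ ?_
  obtain ⟨b, -⟩ := exists_binaryBicone_total A B hprod
  exact faltingsTateMap_surjective_of_finite ℓ hℓ b (hfin _) (hq _) (hfree _) (hfinT _) (hss _)
    (hsat hℓ)

end Integral

end Literature.AlgebraicGeometry.Motives
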